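import Literature.MathematicalPhysics.QuantumFieldTheory.Balaban1983to89.B4Eq213ConcreteWalk
import Literature.MathematicalPhysics.QuantumFieldTheory.Balaban1983to89.B4LpChain221

/-!
# `Balaban1983to89.B4Eq212SmallR` — [Balaban1983RegularityDecay] p. 577 «R is a small operator in reasonable norms»:
`‖R‖_∞→∞ ≤ 2^d · max_j ‖K_jG_k(□_j)h_j‖` for [B4]'s concrete `R` (2.11) by ROW MULTIPLICITY, hence the hypothesis
`‖R‖ < 1` of `B4Eq213ConcreteWalk.concrete_walk_decay_bound` DISCHARGED from the factor bound `3^dβ < 1`; v1.1: the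
exponential form (2.21)–(2.22) under the printed choice `3^dβ ≤ e⁻¹`; v1.2: docstring-only citation fix
«(2.30) p.581» → p.580 (summit-lit1 CITELOC P69-008; Cor. 2.3 (2.30) is the last display of p. 580), declarations unchanged

statement-level skeleton of published theorems with citation tags; proofs where landed; nothing here is a claim about the Yang–Mills mass gap

CITATION HEADER.  T. Bałaban, *Regularity and decay of lattice Green's functions*, Commun. Math. Phys. **89** (1983)
571–597, doi:10.1007/bf01214744 [Balaban1983RegularityDecay] (cell paper B4; held text
`paper:balaban1983-cmp89-regularity-decay`, journal page = PDF page + 570; pp. 576–579).  Unit `lit-balaban-r01` gen 5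
(B4 fold owner), HOME `run/shared/lean/pub/lit-balaban/`, SKELETON rows **B4.Eq2.12** ((2.12)–(2.13)), **B4.Eq2.10**
((2.10)–(2.11)), **B4.Eq2.18** ((2.18)–(2.22)).  Theorems only; imports `B4Eq213ConcreteWalk` (+ v1.1 `B4LpChain221` for
`tail_222`).  Norm: Mathlib's scope
`Matrix.Norms.Operator` (`‖A‖ = max_i Σ_j |A_{ij}|`, the `ℓ^∞ → ℓ^∞` operator norm).

WHAT IS PRINTED (verbatim, p. 577).  *«In the sequel we will see that R is a small operator in reasonable norms because
|∂^ηh_j| ≤ O(M⁻¹), |Δ^ηh_j| ≤ O(M⁻²), so we have the representations (2.12) G_k(Ω,A) = G₀(I − R)⁻¹ = Σ_{n=0}^∞ G₀Rⁿ.»*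
(with (2.11) `R = Σ_j K_jG_k(□_j,Ã_j)h_j` p. 576 and the factor bound (2.20) «‖K_{ω_i}G_k(□_{ω_i},Ã_{ω_i})h_{ω_i}f‖ ≤
c₂O(1)M⁻¹‖f‖» p. 579).

WHAT THIS MODULE PROVES (all in full).
* `norm_sum_le_of_rowMult` (§1) — the counting lemma: if every `b l` (`l ∈ s`) has `ℓ^∞`-operator norm `≤ β` and row `i`
  of `b l` vanishes unless `l ∈ near i`, `|near i| ≤ m₀`, then `‖Σ_{l∈s} b l‖ ≤ m₀β`.
* `mem_nearBox_of_near` (§2) — the labels `l ∈ Z^d` with `|x − Ml|_∞ < (3/4)M` lie in a box of `2^d` labels;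
  `opK_kernel_row_eq_zero_of_far` / `opK_mul_row_eq_zero_of_far` — the kernel row `z` of `K_l = [h_l, H]` (2.10), for
  bond/block data local at scale `M/8` and the constructed `h_l` (`supp ⊆ {|x − Ml|_∞ < (5/8)M}`), vanishes unless
  `|z − Ml|_∞ < (3/4)M`; so does row `z` of `K_l·B` for every `B`.
* **`norm_R_le`** (§3) — for [B4]'s concrete `R = Σ_{j∈s} K_jG_jh_j` (Neumann-cut cube operators, any `G_j`, the
  constructed `h_j`): `‖R‖ ≤ 2^d·β` whenever every summand has norm `≤ β`; **`norm_R_lt_one`** — `‖R‖ < 1` from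
  `3^dβ < 1`; **`concrete_walk_decay_bound'`** — `B4Eq213ConcreteWalk.concrete_walk_decay_bound` WITHOUT its hypothesis
  `hR : ‖R‖ < 1` (now derived), i.e. the walk decay bound `‖P·G·P′‖ ≤ |S₀|·α·β₁·3^d·(3^dβ)^{N−1}/(1 − 3^dβ)` for the
  concrete operators from the factor bounds `α, β, β₁` (`3^dβ < 1`) and the support cut-offs alone.
* v1.1 (§4) **`concrete_walk_decay_exp`** — (2.21)–(2.22): with the printed choice of `M` («M fixed with
  3^dc₂O(1)M⁻¹ ≤ e⁻¹», here `3^dβ ≤ e⁻¹`) the bound is exponential in the label separation,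
  `‖P·G·P′‖ ≤ |S₀|·α·β₁·3^d·2e²·e^{−r}` for every `r ≤ N + 1` (`B4LpChain221.tail_222`).

HONEST SCOPE.  The factor bounds themselves (Lemma 2.1 at `A ≠ 0`; at zero field on boxes
`B4Eq220PartitionSizes.eq220_hBox`) and the choice of `M` (2.21) are not made here; `2^d` (not the walks' `3^d`) is the
sharp row multiplicity at locality scale `M/8`.  No `def`, no `Prop` fact, no `sorry`; axioms standard.
-/

namespace Literature.MathematicalPhysics.QuantumFieldTheory.Balaban1983to89.B4Eq212SmallR

open Literature.MathematicalPhysics.QuantumFieldTheory.Balaban1983to89.B4GaugeCovariance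
open Literature.MathematicalPhysics.QuantumFieldTheory.Balaban1983to89.B4Commutators25to211
open Literature.MathematicalPhysics.QuantumFieldTheory.Balaban1983to89.B4PartitionUnity22
open Literature.MathematicalPhysics.QuantumFieldTheory.Balaban1983to89.B4RandomWalk213
open Literature.MathematicalPhysics.QuantumFieldTheory.Balaban1983to89.B4Eq213Locality
open Literature.MathematicalPhysics.QuantumFieldTheory.Balaban1983to89.B4Eq26Locality
open Literature.MathematicalPhysics.QuantumFieldTheory.Balaban1983to89.B4Eq213ConcreteWalk
open scoped Matrix NNReal

open scoped Matrix.Norms.Operator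

/-! ## §1. The `ℓ^∞ → ℓ^∞` operator norm of a sum of operators with bounded ROW MULTIPLICITY -/

section Norm

variable {m n ι : Type*} [Fintype m] [Fintype n]

/-- a row sum is at most the `ℓ^∞`-operator norm: `Σ_j |A_{ij}| ≤ ‖A‖ = max_i Σ_j |A_{ij}|`. [folklore] -/
private theorem row_sum_le_norm (A : Matrix m n ℝ) (i : m) : ∑ j, |A i j| ≤ ‖A‖ := by
  rw [Matrix.linfty_opNorm_def]
  have h : (∑ j, ‖A i j‖₊ : ℝ≥0) ≤ Finset.univ.sup fun i => ∑ j, ‖A i j‖₊ :=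
    Finset.le_sup (f := fun i => ∑ j, ‖A i j‖₊) (Finset.mem_univ i)
  have h' := NNReal.coe_le_coe.mpr h
  simp only [NNReal.coe_sum, coe_nnnorm, Real.norm_eq_abs] at h'
  exact h'

/-- the `ℓ^∞`-operator norm is bounded by any common bound of the row sums. [folklore] -/
private theorem norm_le_of_rows (A : Matrix m n ℝ) {C : ℝ} (hC : 0 ≤ C) (h : ∀ i, ∑ j, |A i j| ≤ C) :
    ‖A‖ ≤ C := by
  rw [Matrix.linfty_opNorm_def]
  have : (Finset.univ.sup fun i => ∑ j, ‖A i j‖₊ : ℝ≥0) ≤ C.toNNReal := by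
    refine Finset.sup_le fun i _ => ?_
    rw [← NNReal.coe_le_coe, Real.coe_toNNReal C hC]
    simp only [NNReal.coe_sum, coe_nnnorm, Real.norm_eq_abs]
    exact h i
  have h2 := NNReal.coe_le_coe.mpr this
  rwa [Real.coe_toNNReal C hC] at h2

/-- **BOUNDED ROW MULTIPLICITY ⇒ `‖Σ_l b_l‖_∞→∞ ≤ m₀·max_l ‖b_l‖`** (the counting behind p. 577 *«R is a small operator in
reasonable norms»*: at every point at most `m₀` of the operators `K_jG_k(□_j)h_j` have a non-zero row): if every `b l`,
`l ∈ s`, has norm `≤ β`, and the rows `i` of `b l` vanish unless `l ∈ near i` with `|near i| ≤ m₀`, then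
`‖Σ_{l∈s} b l‖ ≤ m₀β`. [cite: Balaban1983RegularityDecay, (2.11)–(2.12) pp. 576–577] -/
theorem norm_sum_le_of_rowMult (s : Finset ι) (b : ι → Matrix m n ℝ) {β : ℝ} (hβ0 : 0 ≤ β)
    (hβ : ∀ l ∈ s, ‖b l‖ ≤ β) (near : m → Finset ι) {m₀ : ℕ} (hcard : ∀ i, (near i).card ≤ m₀)
    (hnear : ∀ i, ∀ l ∈ s, l ∉ near i → ∀ j, b l i j = 0) :
    ‖∑ l ∈ s, b l‖ ≤ m₀ * β := by
  classical
  apply norm_le_of_rows _ (by positivity)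
  intro i
  have hzero : ∀ l ∈ s, l ∉ near i → ∑ j, |b l i j| = 0 := fun l hl hln =>
    Finset.sum_eq_zero fun j _ => by rw [hnear i l hl hln j, abs_zero]
  calc ∑ j, |(∑ l ∈ s, b l) i j| = ∑ j, |∑ l ∈ s, b l i j| := by simp only [Matrix.sum_apply]
    _ ≤ ∑ j, ∑ l ∈ s, |b l i j| := Finset.sum_le_sum fun j _ => Finset.abs_sum_le_sum_abs _ _
    _ = ∑ l ∈ s, ∑ j, |b l i j| := Finset.sum_comm
    _ = ∑ l ∈ s.filter (· ∈ near i), ∑ j, |b l i j| := by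
        rw [Finset.sum_filter_of_ne]
        intro l hl hne
        by_contra hln
        exact hne (hzero l hl hln)
    _ ≤ ∑ l ∈ s.filter (· ∈ near i), β := Finset.sum_le_sum fun l hl =>
        ((row_sum_le_norm (b l) i).trans (hβ l (Finset.mem_filter.mp hl).1))
    _ = (s.filter (· ∈ near i)).card * β := by rw [Finset.sum_const, nsmul_eq_mul]
    _ ≤ (near i).card * β := by
        have hsub : s.filter (· ∈ near i) ⊆ near i := by
          intro l hl
          exact (Finset.mem_filter.mp hl).2
        exact mul_le_mul_of_nonneg_right (by exact_mod_cast Finset.card_le_card hsub) hβ0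
    _ ≤ m₀ * β := by gcongr; exact hcard i

end Norm

/-! ## §2. The rows of `K_l G_l h_l` live within `(3/4)M` of the centre `Ml`: at most `2^d` labels per point -/

section Rows

variable {X Y κ ι : Type*} [Fintype X] [Fintype Y] [Fintype κ] [DecidableEq X] [DecidableEq κ] [Fintype ι]

omit [Fintype X] [Fintype κ] [DecidableEq X] [DecidableEq κ] in
/-- the labels `l` with `|x_μ − Ml_μ| < (3/4)M` for all `μ` lie in the box `Π_μ {⌊x_μ/M + 3/4⌋ − 1, ⌊x_μ/M + 3/4⌋}` (at most
`2^d` of them). [cite: Balaban1983RegularityDecay, §2 p.575] -/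
theorem mem_nearBox_of_near [DecidableEq ι] {M : ℝ} (hM : 0 < M) {l : ι → ℤ} {x : ι → ℝ}
    (h : ∀ μ, |x μ - M * l μ| < 3 / 4 * M) :
    l ∈ Fintype.piFinset fun μ => ({⌊x μ / M + 3 / 4⌋ - 1, ⌊x μ / M + 3 / 4⌋} : Finset ℤ) := by
  rw [Fintype.mem_piFinset]
  intro μ
  have hμ := h μ
  have h1 : |x μ / M - l μ| < 3 / 4 := by
    rw [show x μ / M - l μ = (x μ - M * l μ) / M by field_simp, abs_div, abs_of_pos hM]
    rwa [div_lt_iff₀ hM]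
  rcases abs_lt.mp h1 with ⟨hlo, hhi⟩
  have hle : l μ ≤ ⌊x μ / M + 3 / 4⌋ := Int.le_floor.mpr (by linarith)
  have hge : ⌊x μ / M + 3 / 4⌋ - 1 ≤ l μ := by
    have h2 : (⌊x μ / M + 3 / 4⌋ : ℝ) < (l μ : ℝ) + 2 := (Int.floor_le _).trans_lt (by linarith)
    have h3 : ⌊x μ / M + 3 / 4⌋ < l μ + 2 := by exact_mod_cast h2
    omega
  rw [Finset.mem_insert, Finset.mem_singleton]
  omega

omit [Fintype X] [Fintype κ] [DecidableEq X] [DecidableEq κ] in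
/-- that box has at most `2^d` elements. [folklore] -/
private theorem card_nearBox_le [DecidableEq ι] (M : ℝ) (x : ι → ℝ) :
    (Fintype.piFinset fun μ => ({⌊x μ / M + 3 / 4⌋ - 1, ⌊x μ / M + 3 / 4⌋} : Finset ℤ)).card
      ≤ 2 ^ Fintype.card ι := by
  rw [Fintype.card_piFinset, ← Finset.card_univ]
  exact Finset.prod_le_pow_card _ _ 2 fun μ _ => Finset.card_le_two

omit [DecidableEq X] [DecidableEq κ] in
/-- a block operator whose kernel row `z` vanishes kills row `z` of every product. [folklore] -/
private theorem blockOp_mul_row_eq_zero {T : Type*} (K : X → X → Matrix κ κ ℝ) (B : Matrix (X × κ) T ℝ) {z : X} (hz : ∀ z', K z z' = 0) (k : κ) (p : T) :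
    (blockOp K * B) (z, k) p = 0 := by
  rw [Matrix.mul_apply]
  refine Finset.sum_eq_zero fun p' _ => ?_
  rw [blockOp_apply, hz p'.1]
  simp

/-- **THE KERNEL ROWS OF `K_l` LIVE NEAR `□_l`**: if `z` is NOT within `(3/4)M` of the centre `Ml` in every coordinate, the
kernel row `z` of `K_l = [h_l, H]` (2.10) vanishes — `h_l(z) = 0`, and any `z′` coupled to `z` by a bond weight or a common
block (data local at scale `M/8`) with `h_l(z′) ≠ 0` would put `z` within `(1/8 + 5/8)M` of `Ml`.
[cite: Balaban1983RegularityDecay, (2.10)–(2.11) p.576] -/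
theorem opK_kernel_row_eq_zero_of_far {M : ℝ} (hM : 0 < M) (pos : X → ι → ℝ) (l : ι → ℤ) (c : X → X → ℝ)
    (a : ℝ) (q : Y → X → ℝ) (W : X → X → Matrix κ κ ℝ) (T : Y → X → Matrix κ κ ℝ)
    (hc : ∀ z z', c z z' ≠ 0 → ∀ μ, |pos z μ - pos z' μ| ≤ 1 / 8 * M)
    (hq : ∀ y z z', q y z ≠ 0 → q y z' ≠ 0 → ∀ μ, |pos z μ - pos z' μ| ≤ 1 / 8 * M)
    {z : X} (hfar : ¬ ∀ μ, |pos z μ - M * l μ| < 3 / 4 * M) (z' : X) :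
    (hCube M l (pos z) - hCube M l (pos z')) •
        (covLapKer c W z z' + a • ∑ y, (q y z * q y z') • ((T y z)ᵀ * T y z')) = 0 := by
  -- `h_l(z) = 0`
  have hlz : hCube M l (pos z) = 0 := by
    by_contra hne
    exact hfar fun μ => (hCube_ne_zero_imp hM hne μ).trans (by nlinarith)
  by_cases hlz' : hCube M l (pos z') = 0
  · rw [hlz, hlz', sub_zero, zero_smul]
  -- `h_l(z′) ≠ 0`: `z′` is within `(5/8)M` of `Ml`, so no coupling `z ~ z′` survives
  have hnear' : ∀ μ, |pos z' μ - M * l μ| < 5 / 8 * M := hCube_ne_zero_imp hM hlz'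
  have hnotcl : ¬ ∀ μ, |pos z μ - pos z' μ| ≤ 1 / 8 * M := by
    intro hcl
    apply hfar
    intro μ
    calc |pos z μ - M * l μ| = |(pos z μ - pos z' μ) + (pos z' μ - M * l μ)| := by ring_nf
      _ ≤ |pos z μ - pos z' μ| + |pos z' μ - M * l μ| := abs_add_le _ _
      _ < 1 / 8 * M + 5 / 8 * M := add_lt_add_of_le_of_lt (hcl μ) (hnear' μ)
      _ = 3 / 4 * M := by ring
  have hzz' : z ≠ z' := by
    rintro rfl
    exact hlz' hlz
  have hc1 : c z z' = 0 := by
    by_contra h0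
    exact hnotcl (hc z z' h0)
  have hc2 : c z' z = 0 := by
    by_contra h0
    apply hnotcl
    intro μ
    rw [abs_sub_comm]
    exact hc z' z h0 μ
  have hK : covLapKer c W z z' = 0 := by
    rw [covLapKer, if_neg hzz', if_neg hzz', hc1, hc2]
    simp
  have hP : ∑ y, (q y z * q y z') • ((T y z)ᵀ * T y z') = 0 := by
    refine Finset.sum_eq_zero fun y _ => ?_
    have : q y z * q y z' = 0 := by
      by_contra h0
      rcases mul_ne_zero_iff.mp h0 with ⟨h1, h2⟩
      exact hnotcl (hq y z z' h1 h2)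
    rw [this, zero_smul]
  rw [hK, hP, smul_zero, add_zero, smul_zero]

/-- hence row `(z, k)` of `K_l·B` vanishes for every operator `B` (↦ `B = G_k(□_l)h_l`).
[cite: Balaban1983RegularityDecay, (2.10)–(2.11) p.576] -/
theorem opK_mul_row_eq_zero_of_far {T₀ : Type*} {M : ℝ} (hM : 0 < M) (pos : X → ι → ℝ) (l : ι → ℤ)
    (c : X → X → ℝ) (m2 a : ℝ) (q : Y → X → ℝ) (W : X → X → Matrix κ κ ℝ) (T : Y → X → Matrix κ κ ℝ)
    (hc : ∀ z z', c z z' ≠ 0 → ∀ μ, |pos z μ - pos z' μ| ≤ 1 / 8 * M)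
    (hq : ∀ y z z', q y z ≠ 0 → q y z' ≠ 0 → ∀ μ, |pos z μ - pos z' μ| ≤ 1 / 8 * M)
    {z : X} (hfar : ¬ ∀ μ, |pos z μ - M * l μ| < 3 / 4 * M) (B : Matrix (X × κ) T₀ ℝ) (k : κ) (p : T₀) :
    (opK c m2 a q W T (fun w => hCube M l (pos w)) * B) (z, k) p = 0 := by
  rw [opK_eq_blockOp]
  exact blockOp_mul_row_eq_zero _ B (fun z' => opK_kernel_row_eq_zero_of_far hM pos l c a q W T hc hq hfar z') k p

end Rows

/-! ## §3. `‖R‖ ≤ 2^d·β < 1`: the hypothesis `hR` of `B4Eq213ConcreteWalk.concrete_walk_decay_bound` DERIVED -/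

section SmallR

variable {X Y κ : Type*} [Fintype X] [Fintype Y] [Fintype κ] [DecidableEq X] [DecidableEq κ] {d : ℕ}

/-- **«R is a small operator in reasonable norms»** (p. 577) for [B4]'s concrete `R = Σ_j K_jG_k(□_j)h_j` (2.11): in the
`ℓ^∞ → ℓ^∞` operator norm, `‖R‖ ≤ 2^d·β` whenever every summand has norm `≤ β` — because at every point `z` at most
`2^d` labels `j` (those with `|z − Mj|_∞ < (3/4)M`) have a non-zero row, the data being local at scale `M/8` and
`supp h_j ⊆ {|x − Mj|_∞ < (5/8)M}`.  With the factor bound `β = c₂O(1)M⁻¹` of (2.20) this is the printed smallness.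
[cite: Balaban1983RegularityDecay, (2.11)–(2.12) pp. 576–577] -/
theorem norm_R_le {M : ℝ} (hM : 0 < M) (pos : X → Fin d → ℝ) (c : X → X → ℝ) (m2 a : ℝ) (q : Y → X → ℝ)
    (hc : ∀ x z', c x z' ≠ 0 → ∀ μ, |pos x μ - pos z' μ| ≤ 1 / 8 * M)
    (hq : ∀ y x z', q y x ≠ 0 → q y z' ≠ 0 → ∀ μ, |pos x μ - pos z' μ| ≤ 1 / 8 * M)
    (s : Finset (Fin d → ℤ)) (S : (Fin d → ℤ) → X → Prop) [∀ j, DecidablePred (S j)]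
    (W' : (Fin d → ℤ) → X → X → Matrix κ κ ℝ) (T' : (Fin d → ℤ) → Y → X → Matrix κ κ ℝ)
    (Gj : (Fin d → ℤ) → Matrix (X × κ) (X × κ) ℝ) {β : ℝ} (hβ0 : 0 ≤ β)
    (hβ : ∀ i : ↥s, ‖opK (fun z z' => if (S i.1 z ↔ S i.1 z') then c z z' else 0) m2 a q (W' i.1) (T' i.1)
        (fun z => hCube M i.1 (pos z)) * Gj i.1 * mulH (ι := κ) (fun z => hCube M i.1 (pos z))‖ ≤ β) :
    ‖∑ j ∈ s, opK (fun z z' => if (S j z ↔ S j z') then c z z' else 0) m2 a q (W' j) (T' j)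
        (fun z => hCube M j (pos z)) * Gj j * mulH (ι := κ) (fun z => hCube M j (pos z))‖ ≤ (2 : ℝ) ^ d * β := by
  have hcut : ∀ l z z', (if (S l z ↔ S l z') then c z z' else 0) ≠ 0 → ∀ μ, |pos z μ - pos z' μ| ≤ 1 / 8 * M :=
    fun l z z' hne μ => cut_local pos c (S l) hc z z' hne μ
  have h := norm_sum_le_of_rowMult s
    (fun j => opK (fun z z' => if (S j z ↔ S j z') then c z z' else 0) m2 a q (W' j) (T' j)
      (fun z => hCube M j (pos z)) * Gj j * mulH (ι := κ) (fun z => hCube M j (pos z)))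
    hβ0 (fun l hl => hβ ⟨l, hl⟩)
    (fun i : X × κ => Fintype.piFinset fun μ => ({⌊pos i.1 μ / M + 3 / 4⌋ - 1, ⌊pos i.1 μ / M + 3 / 4⌋} : Finset ℤ))
    (m₀ := 2 ^ d)
    (fun i => (card_nearBox_le M (pos i.1)).trans (by rw [Fintype.card_fin]))
    (by
      rintro ⟨z, k⟩ l _ hln p
      have hfar : ¬ ∀ μ, |pos z μ - M * l μ| < 3 / 4 * M := fun hnear => hln (mem_nearBox_of_near hM hnear)
      rw [Matrix.mul_assoc]
      exact opK_mul_row_eq_zero_of_far hM pos l _ m2 a q (W' l) (T' l) (hcut l) hq hfar _ k p)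
  exact_mod_cast h

/-- hence `‖R‖ < 1` as soon as `3^dβ < 1` (the walk-convergence condition of (2.21)–(2.22)) — `2^d ≤ 3^d`.
[cite: Balaban1983RegularityDecay, (2.12) p.577, (2.21)–(2.22) pp.578–579] -/
theorem norm_R_lt_one {M : ℝ} (hM : 0 < M) (pos : X → Fin d → ℝ) (c : X → X → ℝ) (m2 a : ℝ) (q : Y → X → ℝ)
    (hc : ∀ x z', c x z' ≠ 0 → ∀ μ, |pos x μ - pos z' μ| ≤ 1 / 8 * M)
    (hq : ∀ y x z', q y x ≠ 0 → q y z' ≠ 0 → ∀ μ, |pos x μ - pos z' μ| ≤ 1 / 8 * M)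
    (s : Finset (Fin d → ℤ)) (S : (Fin d → ℤ) → X → Prop) [∀ j, DecidablePred (S j)]
    (W' : (Fin d → ℤ) → X → X → Matrix κ κ ℝ) (T' : (Fin d → ℤ) → Y → X → Matrix κ κ ℝ)
    (Gj : (Fin d → ℤ) → Matrix (X × κ) (X × κ) ℝ) {β : ℝ} (hβ0 : 0 ≤ β)
    (hβ : ∀ i : ↥s, ‖opK (fun z z' => if (S i.1 z ↔ S i.1 z') then c z z' else 0) m2 a q (W' i.1) (T' i.1)
        (fun z => hCube M i.1 (pos z)) * Gj i.1 * mulH (ι := κ) (fun z => hCube M i.1 (pos z))‖ ≤ β)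
    (h3β : (3 : ℝ) ^ d * β < 1) :
    ‖∑ j ∈ s, opK (fun z z' => if (S j z ↔ S j z') then c z z' else 0) m2 a q (W' j) (T' j)
        (fun z => hCube M j (pos z)) * Gj j * mulH (ι := κ) (fun z => hCube M j (pos z))‖ < 1 := by
  have h23 : (2 : ℝ) ^ d * β ≤ (3 : ℝ) ^ d * β :=
    mul_le_mul_of_nonneg_right (pow_le_pow_left₀ (by norm_num) (by norm_num) d) hβ0
  exact ((norm_R_le hM pos c m2 a q hc hq s S W' T' Gj hβ0 hβ).trans h23).trans_lt h3β

/-- **(2.12)–(2.13) ⇒ (2.22)/(2.30) ON THE CONCRETE OPERATORS, `hR` DISCHARGED**: the statement of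
`B4Eq213ConcreteWalk.concrete_walk_decay_bound` WITHOUT the hypothesis `‖R‖ < 1` — it follows from the factor bound `β`
(`3^dβ < 1`) by `norm_R_lt_one`.  Remaining analytic inputs: the factor bounds `α, β, β₁` (Lemma 2.1 + the p.577 sizes;
at zero field on boxes `B4Eq220PartitionSizes.eq220_hBox`) and the support cut-offs.
[cite: Balaban1983RegularityDecay, (2.12)–(2.13) p.577, (2.22) p.579, (2.30) p.580] -/
theorem concrete_walk_decay_bound' {M : ℝ} (hM : 0 < M) (pos : X → Fin d → ℝ) (c : X → X → ℝ) (m2 a : ℝ)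
    (q : Y → X → ℝ) (W : X → X → Matrix κ κ ℝ) (T : Y → X → Matrix κ κ ℝ)
    (hc : ∀ x z', c x z' ≠ 0 → ∀ μ, |pos x μ - pos z' μ| ≤ 1 / 8 * M)
    (hq : ∀ y x z', q y x ≠ 0 → q y z' ≠ 0 → ∀ μ, |pos x μ - pos z' μ| ≤ 1 / 8 * M)
    (s : Finset (Fin d → ℤ)) (hs : ∀ j x, hCube M j (pos x) ≠ 0 → j ∈ s)
    (S : (Fin d → ℤ) → X → Prop) [∀ j, DecidablePred (S j)]
    (hS : ∀ j z, (∀ μ, |pos z μ - M * j μ| ≤ 7 / 8 * M) → S j z)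
    (W' : (Fin d → ℤ) → X → X → Matrix κ κ ℝ) (T' : (Fin d → ℤ) → Y → X → Matrix κ κ ℝ)
    (hWW' : ∀ j x z', (∀ μ, |pos x μ - M * j μ| ≤ 3 / 4 * M) → (∀ μ, |pos z' μ - M * j μ| ≤ 3 / 4 * M) →
      W' j x z' = W x z')
    (hTT' : ∀ j y x, q y x ≠ 0 → (∀ μ, |pos x μ - M * j μ| ≤ 3 / 4 * M) → T' j y x = T y x)
    (Gj : (Fin d → ℤ) → Matrix (X × κ) (X × κ) ℝ)
    (hGj : ∀ j ∈ s, covOp (fun z z' => if (S j z ↔ S j z') then c z z' else 0) m2 a q (W' j) (T' j) * Gj j = 1)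
    (G : Matrix (X × κ) (X × κ) ℝ) (hGH : G * covOp c m2 a q W T = 1)
    {P P' : Matrix (X × κ) (X × κ) ℝ} {S₀ S₁ : Finset ↥s} {α β β₁ : ℝ} {N : ℕ}
    (hP : ∀ i : ↥s, i ∉ S₀ →
      P * (mulH (ι := κ) (fun z => hCube M i.1 (pos z)) * Gj i.1 * mulH (ι := κ) (fun z => hCube M i.1 (pos z))) = 0)
    (hP'a : ∀ i : ↥s, i ∉ S₁ →
      mulH (ι := κ) (fun z => hCube M i.1 (pos z)) * Gj i.1 * mulH (ι := κ) (fun z => hCube M i.1 (pos z)) * P' = 0)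
    (hP'b : ∀ i : ↥s, i ∉ S₁ →
      opK (fun z z' => if (S i.1 z ↔ S i.1 z') then c z z' else 0) m2 a q (W' i.1) (T' i.1)
        (fun z => hCube M i.1 (pos z)) * Gj i.1 * mulH (ι := κ) (fun z => hCube M i.1 (pos z)) * P' = 0)
    (hα : ∀ i : ↥s,
      ‖P * (mulH (ι := κ) (fun z => hCube M i.1 (pos z)) * Gj i.1 * mulH (ι := κ) (fun z => hCube M i.1 (pos z)))‖ ≤ α)
    (hβ0 : 0 ≤ β)
    (hβ : ∀ i : ↥s, ‖opK (fun z z' => if (S i.1 z ↔ S i.1 z') then c z z' else 0) m2 a q (W' i.1) (T' i.1)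
        (fun z => hCube M i.1 (pos z)) * Gj i.1 * mulH (ι := κ) (fun z => hCube M i.1 (pos z))‖ ≤ β)
    (hβ₁ : ∀ i : ↥s, ‖opK (fun z z' => if (S i.1 z ↔ S i.1 z') then c z z' else 0) m2 a q (W' i.1) (T' i.1)
        (fun z => hCube M i.1 (pos z)) * Gj i.1 * mulH (ι := κ) (fun z => hCube M i.1 (pos z)) * P'‖ ≤ β₁)
    (h3β : (3 : ℝ) ^ d * β < 1) (hN : 1 ≤ N)
    (hsep : ∀ i ∈ S₀, ∀ l ∈ S₁, ∃ μ, (N : ℤ) ≤ |i.1 μ - l.1 μ|) :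
    ‖P * G * P'‖ ≤ S₀.card * α * β₁ * (3 : ℝ) ^ d * ((3 : ℝ) ^ d * β) ^ (N - 1) / (1 - (3 : ℝ) ^ d * β) :=
  concrete_walk_decay_bound hM pos c m2 a q W T hc hq s hs S hS W' T' hWW' hTT' Gj hGj G hGH
    (norm_R_lt_one hM pos c m2 a q hc hq s S W' T' Gj hβ0 hβ h3β)
    hP hP'a hP'b hα hβ0 hβ hβ₁ h3β hN hsep

end SmallR

end Literature.MathematicalPhysics.QuantumFieldTheory.Balaban1983to89.B4Eq212SmallR

namespace Literature.MathematicalPhysics.QuantumFieldTheory.Balaban1983to89.B4Eq212SmallR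

open Literature.MathematicalPhysics.QuantumFieldTheory.Balaban1983to89.B4GaugeCovariance
open Literature.MathematicalPhysics.QuantumFieldTheory.Balaban1983to89.B4Commutators25to211
open Literature.MathematicalPhysics.QuantumFieldTheory.Balaban1983to89.B4PartitionUnity22
open Literature.MathematicalPhysics.QuantumFieldTheory.Balaban1983to89.B4Eq213ConcreteWalk
open Literature.MathematicalPhysics.QuantumFieldTheory.Balaban1983to89.B4LpChain221
open scoped Matrix

open scoped Matrix.Norms.Operator

/-! ## §4. (2.21)–(2.22): with the printed choice of `M` (`3^dβ ≤ e⁻¹`) the walk bound is exponential in the separation -/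

section Exp

variable {X Y κ : Type*} [Fintype X] [Fintype Y] [Fintype κ] [DecidableEq X] [DecidableEq κ] {d : ℕ}

/-- **(2.22) IN EXPONENTIAL FORM ON THE CONCRETE OPERATORS**: with the printed choice of `M` — (2.21) «M fixed with
3^dc₂O(1)M⁻¹ ≤ e⁻¹», here `3^dβ ≤ e⁻¹` — the geometric walk bound of `concrete_walk_decay_bound'` becomes
`‖P·G·P′‖ ≤ |S₀|·α·β₁·3^d·2e²·e^{−r}` for every `r ≤ N + 1`, `N` the label separation of the support cut-offs
(`B4LpChain221.tail_222`; in print `r ↦ δ₀·dist(supp f, supp f′)` via (2.19)).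
[cite: Balaban1983RegularityDecay, (2.21)–(2.22) pp. 578–579] -/
theorem concrete_walk_decay_exp {M : ℝ} (hM : 0 < M) (pos : X → Fin d → ℝ) (c : X → X → ℝ) (m2 a : ℝ)
    (q : Y → X → ℝ) (W : X → X → Matrix κ κ ℝ) (T : Y → X → Matrix κ κ ℝ)
    (hc : ∀ x z', c x z' ≠ 0 → ∀ μ, |pos x μ - pos z' μ| ≤ 1 / 8 * M)
    (hq : ∀ y x z', q y x ≠ 0 → q y z' ≠ 0 → ∀ μ, |pos x μ - pos z' μ| ≤ 1 / 8 * M)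
    (s : Finset (Fin d → ℤ)) (hs : ∀ j x, hCube M j (pos x) ≠ 0 → j ∈ s)
    (S : (Fin d → ℤ) → X → Prop) [∀ j, DecidablePred (S j)]
    (hS : ∀ j z, (∀ μ, |pos z μ - M * j μ| ≤ 7 / 8 * M) → S j z)
    (W' : (Fin d → ℤ) → X → X → Matrix κ κ ℝ) (T' : (Fin d → ℤ) → Y → X → Matrix κ κ ℝ)
    (hWW' : ∀ j x z', (∀ μ, |pos x μ - M * j μ| ≤ 3 / 4 * M) → (∀ μ, |pos z' μ - M * j μ| ≤ 3 / 4 * M) →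
      W' j x z' = W x z')
    (hTT' : ∀ j y x, q y x ≠ 0 → (∀ μ, |pos x μ - M * j μ| ≤ 3 / 4 * M) → T' j y x = T y x)
    (Gj : (Fin d → ℤ) → Matrix (X × κ) (X × κ) ℝ)
    (hGj : ∀ j ∈ s, covOp (fun z z' => if (S j z ↔ S j z') then c z z' else 0) m2 a q (W' j) (T' j) * Gj j = 1)
    (G : Matrix (X × κ) (X × κ) ℝ) (hGH : G * covOp c m2 a q W T = 1)
    {P P' : Matrix (X × κ) (X × κ) ℝ} {S₀ S₁ : Finset ↥s} {α β β₁ : ℝ} {N : ℕ}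
    (hP : ∀ i : ↥s, i ∉ S₀ →
      P * (mulH (ι := κ) (fun z => hCube M i.1 (pos z)) * Gj i.1 * mulH (ι := κ) (fun z => hCube M i.1 (pos z))) = 0)
    (hP'a : ∀ i : ↥s, i ∉ S₁ →
      mulH (ι := κ) (fun z => hCube M i.1 (pos z)) * Gj i.1 * mulH (ι := κ) (fun z => hCube M i.1 (pos z)) * P' = 0)
    (hP'b : ∀ i : ↥s, i ∉ S₁ →
      opK (fun z z' => if (S i.1 z ↔ S i.1 z') then c z z' else 0) m2 a q (W' i.1) (T' i.1)
        (fun z => hCube M i.1 (pos z)) * Gj i.1 * mulH (ι := κ) (fun z => hCube M i.1 (pos z)) * P' = 0)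
    (hα : ∀ i : ↥s,
      ‖P * (mulH (ι := κ) (fun z => hCube M i.1 (pos z)) * Gj i.1 * mulH (ι := κ) (fun z => hCube M i.1 (pos z)))‖ ≤ α)
    (hβ0 : 0 ≤ β)
    (hβ : ∀ i : ↥s, ‖opK (fun z z' => if (S i.1 z ↔ S i.1 z') then c z z' else 0) m2 a q (W' i.1) (T' i.1)
        (fun z => hCube M i.1 (pos z)) * Gj i.1 * mulH (ι := κ) (fun z => hCube M i.1 (pos z))‖ ≤ β)
    (hβ₁ : ∀ i : ↥s, ‖opK (fun z z' => if (S i.1 z ↔ S i.1 z') then c z z' else 0) m2 a q (W' i.1) (T' i.1)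
        (fun z => hCube M i.1 (pos z)) * Gj i.1 * mulH (ι := κ) (fun z => hCube M i.1 (pos z)) * P'‖ ≤ β₁)
    (h3β : (3 : ℝ) ^ d * β ≤ Real.exp (-1)) (hN : 1 ≤ N)
    (hsep : ∀ i ∈ S₀, ∀ l ∈ S₁, ∃ μ, (N : ℤ) ≤ |i.1 μ - l.1 μ|) {r : ℝ} (hr : r - 2 ≤ ((N - 1 : ℕ) : ℝ)) :
    ‖P * G * P'‖ ≤ S₀.card * α * β₁ * (3 : ℝ) ^ d * (2 * Real.exp 2 * Real.exp (-r)) := by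
  have h3β' : (3 : ℝ) ^ d * β < 1 := h3β.trans_lt (Real.exp_lt_one_iff.mpr (by norm_num))
  have hb := concrete_walk_decay_bound' hM pos c m2 a q W T hc hq s hs S hS W' T' hWW' hTT' Gj hGj G hGH
    hP hP'a hP'b hα hβ0 hβ hβ₁ h3β' hN hsep
  rw [mul_div_assoc] at hb
  have htail := tail_222 (by positivity : 0 ≤ (3 : ℝ) ^ d * β) h3β hr
  have hC : 0 ≤ (S₀.card : ℝ) * α * β₁ * (3 : ℝ) ^ d := by
    rcases Finset.eq_empty_or_nonempty S₀ with hS0 | ⟨i, hi⟩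
    · simp [hS0]
    · have hα0 : 0 ≤ α := (norm_nonneg _).trans (hα i)
      have hβ₁0 : 0 ≤ β₁ := (norm_nonneg _).trans (hβ₁ i)
      positivity
  exact hb.trans (mul_le_mul_of_nonneg_left htail hC)

end Exp

end Literature.MathematicalPhysics.QuantumFieldTheory.Balaban1983to89.B4Eq212SmallR
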